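import Summits.Ventures.YMGap.RobustBall.Targets
import Summits.Ventures.YMGap.RobustBall.ParallelPairCode
import HarnessLib

/-!
# RobustBall/ParallelPairWitness — T0.2 witness (w3): the parallel-plaquette-pair action is in the tier-1 ball
(cell `pub-ymgap`, track Y2 ROBUST-BALL; p1)

HONEST FRAMING: a MEMBERSHIP CERTIFICATE for one concrete genuinely non-loop member of the robust ball of
`RobustBall/Defs` — the parallel-pair action `τ Σ (Re tr U_p/N)(Re tr U_{p+e_k}/N)` over plaquettes `p = (x; i<j)` and
transverse directions `k` — finite-torus bookkeeping only (no expansion, no continuum, no Clay claim). It discharges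
`ParallelPairWitnessTargetC N d` of `RobustBall/Targets` AS TYPED (landed, site-based incidence): for every torus
`L ≥ 3` (indeed every `L`) the action is a `Perturbation d L N` with the typed total, lies in
`ClusterDomainFR (8(d−1)(d−2)|τ|) (24d(d−1)(d−2)|τ|/√N) 2`, and is slab-local with vertical dependence diameter `2`.

Construction: pair terms (`RobustBall/PairActivity`) over ORDERED distinct direction triples with coefficient `τ/2`
(the pair is symmetric under `i ↔ j`), polymers `pairCode` in the unit cube (`RobustBall/ParallelPairCode`: range and
vertical windows from the code alone), the generic assembly and site-incidence load formulas of
`RobustBall/TermPerturbation`, and the counts `Σ_r mult_r(e) = 8(d−1)(d−2)`, `≤ 6·d(d−1)(d−2)` terms through a site,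
`8` letters each.
-/

noncomputable section

open MeasureTheory Finset Function
open Literature.Probability.LatticeModels Literature.Probability.LatticeModels.DobrushinMetric
open Literature.MathematicalPhysics.QuantumLattice hiding torusNorm
open Literature.MathematicalPhysics.QuantumFieldTheory hiding ZdEdge

namespace Summit.Ventures.YMGap.RobustBall

variable {d L N : ℕ}

/-! ### The family of pair terms -/

section Family

variable (N : ℕ) (τ : ℝ)

variable (d L) in
/-- The family of PAIR TERMS indexed by a base point and an ORDERED distinct triple `(i, j, k)`, coefficient `τ/2`
(each unordered parallel pair `{(x; i<j), (x+e_k; i<j)}` appears twice, as `(i,j,k)` and `(j,i,k)`). [folklore] -/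
def pairFamily (r : Site d L × OTrip d) : LocalTerm d L N :=
  LocalTerm.ofPair N (τ / 2) (plaqWord r.1 r.2.1.1 r.2.1.2.1) (plaqWord (r.1 + unitVec r.2.1.2.2) r.2.1.1 r.2.1.2.1)
    (pairCode r.1 r.2.1.1 r.2.1.2.1 r.2.1.2.2) r.1 (r.1 + unitVec r.2.1.2.2)
    (isWalk_plaqWord r.1 _ _) (isWalk_plaqWord _ _ _) fun _ hl => site_mem_pairCode hl

/-- The activity of a pair term is HALF the tree's `parallelPairActivity`. [folklore] -/
theorem pairFamily_act [NeZero L] (r : Site d L × OTrip d) (U : GaugeConfig d L (SUN N)) :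
    (pairFamily d L N τ r).act U = parallelPairActivity N τ r.1 r.2.1.1 r.2.1.2.1 r.2.1.2.2 U / 2 := by
  show pairActivity N (τ / 2) _ _ U = _
  simp only [pairActivity, traceObs, wordProd_plaqWord, parallelPairActivity, unitVec]
  ring

/-- The letters of a pair term. [folklore] -/
@[simp] theorem pairFamily_letters (r : Site d L × OTrip d) :
    (pairFamily d L N τ r).letters =
      plaqWord r.1 r.2.1.1 r.2.1.2.1 ++ plaqWord (r.1 + unitVec r.2.1.2.2) r.2.1.1 r.2.1.2.1 := rfl

/-- The polymer of a pair term. [folklore] -/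
@[simp] theorem pairFamily_code (r : Site d L × OTrip d) :
    (pairFamily d L N τ r).code = pairCode r.1 r.2.1.1 r.2.1.2.1 r.2.1.2.2 := rfl

/-- The oscillation constant of a pair term: `2|τ/2| = |τ|`. [folklore] -/
@[simp] theorem pairFamily_oscC (r : Site d L × OTrip d) : (pairFamily d L N τ r).oscC = |τ| := by
  show 2 * |τ / 2| = |τ|
  rw [abs_div, abs_two]; ring

/-- The Lipschitz constant of a pair term: `|τ|/2/√N`. [folklore] -/
@[simp] theorem pairFamily_lipC (r : Site d L × OTrip d) : (pairFamily d L N τ r).lipC = |τ| / 2 / Real.sqrt N := by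
  show |τ / 2| / Real.sqrt N = _
  rw [abs_div, abs_two]

/-- A pair term has eight letters. [folklore] -/
@[simp] theorem length_pairFamily_letters (r : Site d L × OTrip d) : (pairFamily d L N τ r).letters.length = 8 := rfl

end Family

/-- The tree's parallel-pair activity is symmetric under `i ↔ j` (`Re tr U_{(x;j,i)} = Re tr U_{(x;i,j)}`). [folklore] -/
theorem parallelPairActivity_swap [NeZero L] (τ : ℝ) (x : Site d L) (i j k : Fin d)
    (U : GaugeConfig d L (SUN N)) :
    parallelPairActivity N τ x j i k U = parallelPairActivity N τ x i j k U := by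
  simp only [parallelPairActivity, re_trace_plaquetteHolonomy_swap]

/-! ### Counts -/

section Counts

variable [NeZero L] (N : ℕ) (τ : ℝ)

/-- Casting `(d−1)(d−2)` (natural subtraction) to `ℝ` for `1 ≤ d`. [folklore] -/
theorem cast_sub_one_mul_sub_two (hd : 1 ≤ d) : (((d - 1) * (d - 2) : ℕ) : ℝ) = ((d : ℝ) - 1) * ((d : ℝ) - 2) := by
  rcases Nat.lt_or_ge d 2 with h | h
  · obtain rfl : d = 1 := by omega
    norm_num
  · push_cast [Nat.cast_sub hd, Nat.cast_sub h]; ring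

/-- **The letter count through a link**: `Σ_r mult_{letters r}(e) = 8(d−1)(d−2)`. [folklore] -/
theorem sum_mult_pairFamily (e : Edge d L) :
    ∑ r : Site d L × OTrip d, mult ((pairFamily d L N τ r).letters) e = 8 * ((d - 1) * (d - 2)) := by
  have h1 := sum_otrip_ite_fst (d := d) e.2
  have h2 := sum_otrip_ite_snd (d := d) e.2
  have hsplit : ∀ r : Site d L × OTrip d, mult ((pairFamily d L N τ r).letters) e =
      mult (plaqWord r.1 r.2.1.1 r.2.1.2.1) e + mult (plaqWord (r.1 + unitVec r.2.1.2.2) r.2.1.1 r.2.1.2.1) e := by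
    intro r; simp [mult, List.map_append, List.count_append]
  simp_rw [hsplit]
  rw [Fintype.sum_prod_type_right]
  simp_rw [sum_add_distrib, sum_mult_plaqWord_add, sum_mult_plaqWord]
  simp only [sum_add_distrib, ← mul_sum, h1, h2]
  ring

/-- The letter count through a link, over `ℝ`. [folklore] -/
theorem sum_mult_pairFamily_real (e : Edge d L) :
    ∑ r : Site d L × OTrip d, (mult ((pairFamily d L N τ r).letters) e : ℝ) = 8 * (((d : ℝ) - 1) * ((d : ℝ) - 2)) := by
  have hd : 1 ≤ d := Nat.succ_le_of_lt (Fin.pos e.2)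
  have h := sum_mult_pairFamily N τ e
  have h' : ((∑ r : Site d L × OTrip d, mult ((pairFamily d L N τ r).letters) e : ℕ) : ℝ) =
      ((8 * ((d - 1) * (d - 2)) : ℕ) : ℝ) := by rw [h]
  rw [Nat.cast_mul, cast_sub_one_mul_sub_two hd] at h'
  push_cast at h' ⊢
  exact h'

/-- `#OTrip d = d(d−1)(d−2)` over `ℝ`. [folklore] -/
theorem card_otrip_real (hd : 1 ≤ d) : (Fintype.card (OTrip d) : ℝ) = (d : ℝ) * (((d : ℝ) - 1) * ((d : ℝ) - 2)) := by
  rw [← card_univ, card_eq_sum_ones, sum_otrip_one, mul_assoc, Nat.cast_mul, cast_sub_one_mul_sub_two hd]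

/-- **The site count** (landed, site-based incidence): the Lipschitz mass of all pair terms whose polymer contains the
base site of `e`: `≤ (|τ|/(2√N)) · 8 · 6 · d(d−1)(d−2) = 24 d(d−1)(d−2)|τ|/√N`. [folklore] -/
theorem sum_site_pairFamily_le (e : Edge d L) :
    ∑ r, (if e.1 ∈ (pairFamily d L N τ r).code then
        (pairFamily d L N τ r).lipC * ((pairFamily d L N τ r).letters.length : ℝ) else 0) ≤
      24 * (d : ℝ) * ((d : ℝ) - 1) * ((d : ℝ) - 2) * |τ| / Real.sqrt N := by
  have hd : 1 ≤ d := Nat.succ_le_of_lt (Fin.pos e.2)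
  have hc : 0 ≤ |τ| / 2 / Real.sqrt N := by positivity
  have hinner : ∀ t : OTrip d,
      ∑ x : Site d L, (if e.1 ∈ pairCode x t.1.1 t.1.2.1 t.1.2.2 then |τ| / 2 / Real.sqrt N * (8 : ℝ) else 0) ≤
        6 * (|τ| / 2 / Real.sqrt N * 8) := by
    intro t
    rw [← sum_filter, sum_const, nsmul_eq_mul]
    have := card_filter_mem_pairCode_le (e.1) t.1.1 t.1.2.1 t.1.2.2
    have : ((univ.filter fun x : Site d L => e.1 ∈ pairCode x t.1.1 t.1.2.1 t.1.2.2).card : ℝ) ≤ 6 := by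
      exact_mod_cast this
    nlinarith
  calc ∑ r, (if e.1 ∈ (pairFamily d L N τ r).code then
          (pairFamily d L N τ r).lipC * ((pairFamily d L N τ r).letters.length : ℝ) else 0)
      = ∑ t : OTrip d, ∑ x : Site d L,
          (if e.1 ∈ pairCode x t.1.1 t.1.2.1 t.1.2.2 then |τ| / 2 / Real.sqrt N * (8 : ℝ) else 0) := by
        rw [Fintype.sum_prod_type_right]
        simp only [pairFamily_code, pairFamily_lipC, length_pairFamily_letters, Nat.cast_ofNat]
    _ ≤ ∑ _t : OTrip d, 6 * (|τ| / 2 / Real.sqrt N * 8) := sum_le_sum fun t _ => hinner t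
    _ = 24 * (d : ℝ) * ((d : ℝ) - 1) * ((d : ℝ) - 2) * |τ| / Real.sqrt N := by
        rw [sum_const, card_univ, nsmul_eq_mul, card_otrip_real hd]
        ring

end Counts

/-! ### Symmetrisation `(i, j, k)` ordered ↦ `i < j` -/

/-- An `i ≠ j` indicator splits into `i < j` and `j < i`. [folklore] -/
theorem ite_ne_eq_add {i j : Fin d} (a : ℝ) :
    (if i ≠ j then a else 0) = (if i < j then a else 0) + (if j < i then a else 0) := by
  rcases lt_trichotomy i j with h | h | h
  · simp [h, h.ne, not_lt_of_gt h]
  · simp [h]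
  · simp [h, h.ne', not_lt_of_gt h]

/-- **Symmetrisation**: for `f` symmetric in its first two arguments, summing `f/2` over ordered distinct triples
equals summing `f` over `i < j`. [folklore] -/
theorem sum_ordered_half_eq_sum_lt (f : Fin d → Fin d → Fin d → ℝ) (hf : ∀ i j k, f j i k = f i j k) :
    ∑ i, ∑ j, ∑ k, (if (i ≠ j ∧ k ≠ i ∧ k ≠ j) then f i j k / 2 else 0) =
      ∑ i, ∑ j, ∑ k, (if (i < j ∧ k ≠ i ∧ k ≠ j) then f i j k else 0) := by
  have hAs : ∀ i j : Fin d,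
      (∑ k, if (k ≠ j ∧ k ≠ i) then f j i k else 0) = ∑ k, if (k ≠ i ∧ k ≠ j) then f i j k else 0 :=
    fun i j => sum_congr rfl fun k _ => by rw [hf]; simp only [and_comm]
  have hL : ∀ i j : Fin d, (∑ k, if (i ≠ j ∧ k ≠ i ∧ k ≠ j) then f i j k / 2 else 0) =
      if i ≠ j then (∑ k, if (k ≠ i ∧ k ≠ j) then f i j k else 0) / 2 else 0 := by
    intro i j
    by_cases h : i ≠ j
    · rw [if_pos h, Finset.sum_div]
      refine sum_congr rfl fun k _ => ?_
      by_cases hk : k ≠ i ∧ k ≠ j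
      · rw [if_pos ⟨h, hk⟩, if_pos hk]
      · rw [if_neg (fun h' => hk h'.2), if_neg hk, zero_div]
    · rw [if_neg h]
      exact sum_eq_zero fun k _ => if_neg fun h' => h h'.1
  have hR : ∀ i j : Fin d, (∑ k, if (i < j ∧ k ≠ i ∧ k ≠ j) then f i j k else 0) =
      if i < j then (∑ k, if (k ≠ i ∧ k ≠ j) then f i j k else 0) else 0 := by
    intro i j
    by_cases h : i < j
    · rw [if_pos h]
      refine sum_congr rfl fun k _ => ?_
      by_cases hk : k ≠ i ∧ k ≠ j
      · rw [if_pos ⟨h, hk⟩, if_pos hk]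
      · rw [if_neg (fun h' => hk h'.2), if_neg hk]
    · rw [if_neg h]
      exact sum_eq_zero fun k _ => if_neg fun h' => h h'.1
  simp_rw [hL, hR, ite_ne_eq_add, sum_add_distrib]
  have hswap : ∑ i : Fin d, ∑ j : Fin d, (if j < i then (∑ k, if (k ≠ i ∧ k ≠ j) then f i j k else 0) / 2 else 0) =
      ∑ i : Fin d, ∑ j : Fin d, (if i < j then (∑ k, if (k ≠ i ∧ k ≠ j) then f i j k else 0) / 2 else 0) := by
    rw [sum_comm]
    exact sum_congr rfl fun a _ => sum_congr rfl fun b _ => by rw [hAs a b]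
  rw [hswap, ← sum_add_distrib]
  refine sum_congr rfl fun i _ => ?_
  rw [← sum_add_distrib]
  refine sum_congr rfl fun j _ => ?_
  split_ifs <;> ring

/-! ### The witness -/

section Witness

variable [NeZero L] (N : ℕ) (τ : ℝ)

/-- **Total** of the pair perturbation: the typed parallel-pair action. [folklore] -/
theorem total_pairFamily (U : GaugeConfig d L (SUN N)) :
    (termPerturbation (pairFamily d L N τ)).total U =
      ∑ x : Site d L, ∑ i : Fin d, ∑ j : Fin d, ∑ k : Fin d,
        if i < j ∧ k ≠ i ∧ k ≠ j then parallelPairActivity N τ x i j k U else 0 := by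
  rw [total_termPerturbation, Fintype.sum_prod_type]
  refine sum_congr rfl fun x _ => ?_
  simp only [pairFamily_act]
  rw [sum_otrip_eq (fun i j k => parallelPairActivity N τ x i j k U / 2)]
  exact sum_ordered_half_eq_sum_lt _ fun i j k => parallelPairActivity_swap τ x i j k U

/-- **Membership** (landed, site-based incidence): the pair perturbation lies in
`ClusterDomainFR (8(d−1)(d−2)|τ|) (24 d (d−1)(d−2)|τ|/√N) 2`. [folklore] -/
theorem pairFamily_mem_clusterDomainFR :
    termPerturbation (pairFamily d L N τ) ∈
      ClusterDomainFR (8 * ((d : ℝ) - 1) * ((d : ℝ) - 2) * |τ|)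
        (24 * (d : ℝ) * ((d : ℝ) - 1) * ((d : ℝ) - 2) * |τ| / Real.sqrt N) 2 := by
  refine termPerturbation_mem_clusterDomainFR (pairFamily d L N τ)
    (fun r => polymerDiam_pairCode_le r.2.2.2.1 r.2.2.2.2) (fun e => ?_) (fun e => sum_site_pairFamily_le N τ e)
  simp only [pairFamily_oscC]
  rw [← mul_sum, sum_mult_pairFamily_real]
  linarith [abs_nonneg τ]

/-- **Vertical dependence diameter `2`** of the pair perturbation (from the codes; no injectivity). [folklore] -/
theorem hasVertRange_pairFamily : HasVertRange 2 (termPerturbation (pairFamily d L N τ)) :=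
  hasVertRange_termPerturbation_of_code (pairFamily d L N τ) fun r v => window_pairCode r.2.2.2.1 r.2.2.2.2 v

/-- **Slab-locality** of the pair perturbation: centre-slab invariant (balanced plaquette words) with vertical
dependence diameter `2`. [folklore] -/
theorem isSlabLocal_pairFamily : IsSlabLocal 2 (termPerturbation (pairFamily d L N τ)) :=
  isSlabLocal_termPerturbation_of_code (pairFamily d L N τ)
    (fun r v t _z hz U =>
      pairActivity_centerSlabRotate (netCount_plaqWord r.2.2.1) (netCount_plaqWord r.2.2.1) (τ / 2) v t hz U)
    fun r v => window_pairCode r.2.2.2.1 r.2.2.2.2 v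

end Witness

/-- **T0.2 witness (w3): the parallel-plaquette-pair action is in the LANDED tier-1 ball** (site-based incidence),
with the loads of `RobustBall/Targets.ParallelPairWitnessTargetC` AS TYPED: oscillation load `8(d−1)(d−2)|τ|`,
Lipschitz load `24 d (d−1)(d−2)|τ|/√N`, range `2`, vertical dependence diameter `2`, centre-slab invariant — for
every coefficient `τ`, every `N`, `d` and every torus. [folklore] -/
theorem parallelPairWitnessTargetC_holds (N d : ℕ) : ParallelPairWitnessTargetC N d := by
  intro τ L _ _
  exact ⟨termPerturbation (pairFamily d L N τ), total_pairFamily N τ, pairFamily_mem_clusterDomainFR N τ,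
    hasVertRange_pairFamily N τ, isSlabLocal_pairFamily N τ⟩

end Summit.Ventures.YMGap.RobustBall

end
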